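import Mathlib.RingTheory.Derivation.Basic
import Mathlib.RingTheory.UniqueFactorizationDomain.Multiplicity
import Mathlib.RingTheory.LocalRing.Basic
import HarnessLib

/-!
# Crux `FolLU` (stmt-ResolutionOfSingularities-17081), line `birth` — saturating a multiplicative derivation

Route `ResolutionOfSingularities/FoliationDescent`. The abstract ring-theoretic core of the remark
"the cut of line `birth` loses nothing" (`FolLU ⇒ stub_orderReduction ∧ stub_nilpotentExit`) and of
the saturation step inside the sibling crux `LogCanQuotLU`:

**Theorem (`exists_isUnit_apply_of_iterate_smul_eq_mul`).** Let `R` be a local domain which is a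
UFD, `d ≠ 0` a derivation of `R`, `f ∈ R` non-zero and NOT a unit, `u ∈ R` a unit, `p ≥ 2`, and
suppose the rescaled derivation `δ := f • d` is MULTIPLICATIVE: `δ^[p] = u · δ` on `R`. Then `d` is
NON-SINGULAR: some value `d x` is a unit.

In words: a multiplicative (`p`-closed with unit multiplier) derivation that is divisible by a
non-unit has a non-singular saturation. Consequently the conclusion of `FolLU` (non-singular or
multiplicative, for SOME rescaling `g • D ↷ S'_c`) is always attained by the SATURATED rescaling.

Proof (orders along a prime factor `π` of `f`; no characteristic hypothesis is needed).
* If `π² ∣ f` or `π ∣ d π`, then `π^j ∣ z ⇒ π^{j+1} ∣ δ z`, so `δ` raises `π`-adic order and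
  `δ^[p] x = u δ x` forces `π^n ∣ δ x` for all `n`, i.e. `δ x = 0` for all `x`: contradiction.
* Otherwise `f = π v` with `π ∤ v`, `π ∤ d π`. Inductively `δ^[m] π = π y_m` with
  `y_m ≡ (v dπ)^m (mod π)`; comparing with `u δ π = π u v dπ` gives `π ∣ v dπ ((v dπ)^{p-1} − u)`,
  and if every value of `d` is a non-unit then `(v dπ)^{p-1} − u` is a unit of the local ring `R`,
  so `π ∣ v` or `π ∣ dπ` or `π` is a unit — contradiction.

Lead prover of line `birth`, 2026-08-17. Definition-free; kernel-only.
-/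

set_option linter.dupNamespace false -- mandated namespace of this single-conjunct summit

namespace Summit.ResolutionOfSingularities.ResolutionOfSingularities.Theorems.FolLU.SatMult

variable {R : Type*} [CommRing R]

/-- Power rule for a derivation of a commutative ring: `d (a^(n+1)) = (n+1) • (a^n d a)`.
[folklore] -/
theorem apply_pow_succ (d : Derivation ℤ R R) (a : R) (n : ℕ) :
    d (a ^ (n + 1)) = (n + 1 : ℕ) • (a ^ n * d a) := by
  rw [d.leibniz_pow]
  simp

/-- Leibniz along a power of `π`: `d (π^j y) = π^j d y + j π^(j-1) dπ y` (for `j = 0` the second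
term vanishes). [folklore] -/
theorem apply_pow_mul (d : Derivation ℤ R R) (π y : R) (j : ℕ) :
    d (π ^ j * y) = π ^ j * d y + (j : R) * π ^ (j - 1) * d π * y := by
  rw [d.leibniz, smul_eq_mul, smul_eq_mul]
  cases j with
  | zero => simp
  | succ n =>
    rw [apply_pow_succ, nsmul_eq_mul]
    simp only [Nat.add_sub_cancel, Nat.cast_add, Nat.cast_one]
    ring

/-- `π ∣ d π` implies `π^j ∣ z → π^j ∣ d z`. [folklore] -/
theorem pow_dvd_apply_of_dvd_apply (d : Derivation ℤ R R) {π : R} (hπ : π ∣ d π) (j : ℕ) {z : R}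
    (hz : π ^ j ∣ z) : π ^ j ∣ d z := by
  obtain ⟨y, rfl⟩ := hz
  obtain ⟨w, hw⟩ := hπ
  rw [apply_pow_mul, hw]
  cases j with
  | zero => simp
  | succ n =>
    simp only [Nat.add_sub_cancel]
    exact Dvd.intro (d y + (↑(n + 1) : R) * w * y) (by ring)

/-- `π² ∣ f` implies `π^j ∣ z → π^(j+1) ∣ f * d z`. [folklore] -/
theorem pow_succ_dvd_mul_apply_of_sq_dvd (d : Derivation ℤ R R) {π f : R} (hf : π ^ 2 ∣ f) (j : ℕ)
    {z : R} (hz : π ^ j ∣ z) : π ^ (j + 1) ∣ f * d z := by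
  obtain ⟨y, rfl⟩ := hz
  obtain ⟨f', rfl⟩ := hf
  rw [apply_pow_mul]
  cases j with
  | zero =>
    simp only [pow_zero, one_mul, Nat.cast_zero, zero_mul, add_zero, zero_add, pow_one]
    exact Dvd.intro (π * f' * d y) (by ring)
  | succ n =>
    simp only [Nat.add_sub_cancel]
    exact Dvd.intro (f' * (π * d y + (↑(n + 1) : R) * d π * y)) (by ring)

/-- `π ∣ f` and `π ∣ d π` imply `π^j ∣ z → π^(j+1) ∣ f * d z`. [folklore] -/
theorem pow_succ_dvd_mul_apply_of_dvd_apply (d : Derivation ℤ R R) {π f : R} (hf : π ∣ f)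
    (hπ : π ∣ d π) (j : ℕ) {z : R} (hz : π ^ j ∣ z) : π ^ (j + 1) ∣ f * d z := by
  obtain ⟨f', rfl⟩ := hf
  rw [pow_succ', mul_assoc]
  exact mul_dvd_mul_left π (Dvd.dvd.mul_left (pow_dvd_apply_of_dvd_apply d hπ j hz) f')

/-- Iterating the order-raising estimate: if `π^j ∣ z → π^(j+1) ∣ δ z` for all `j, z`, then
`π^j ∣ z → π^(j+m) ∣ δ^[m] z`. [folklore] -/
theorem pow_add_dvd_iterate {δ : R → R} {π : R} (h : ∀ (j : ℕ) (z : R), π ^ j ∣ z → π ^ (j + 1) ∣ δ z)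
    (m j : ℕ) {z : R} (hz : π ^ j ∣ z) : π ^ (j + m) ∣ δ^[m] z := by
  induction m generalizing j z with
  | zero => simpa using hz
  | succ m ih =>
    rw [Function.iterate_succ_apply]
    have := ih (j + 1) (h j z hz)
    rwa [show j + 1 + m = j + (m + 1) by omega] at this

/-- **A multiplicative derivation divisible by a non-unit has non-singular saturation.** Let `R`
be a local UFD (domain), `d ≠ 0` a derivation of `R`, `f ≠ 0` a non-unit, `u` a unit, `p ≥ 2`,
and assume `(f • d)^[p] x = u * (f • d) x` for all `x ∈ R`. Then `d x` is a unit for some `x`.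
This is the statement that makes the conclusion of `FolLU` attainable by the SATURATED rescaling,
hence `FolLU ⇒` the open stubs of line `birth` (with stub_saturation), and it is the saturation
step of `LogCanQuotLU`'s multiplicative case. [folklore] -/
theorem stub_satMult :
    ∀ {R : Type} [CommRing R] [IsLocalRing R] [UniqueFactorizationMonoid R]
    (d : Derivation ℤ R R), d ≠ 0 → ∀ {p : ℕ}, 2 ≤ p → ∀ {f u : R}, f ≠ 0 → ¬ IsUnit f → IsUnit u →
    (∀ x : R, (⇑(f • d))^[p] x = u * (f • d) x) → ∃ x : R, IsUnit (d x) := by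
  intro R _ _ _ d hd p hp f u hf0 hf hu hmult
  by_contra hcon
  push Not at hcon
  obtain ⟨π, hπirr, hπf⟩ := WfDvdMonoid.exists_irreducible_factor hf hf0
  have hπ : Prime π := UniqueFactorizationMonoid.irreducible_iff_prime.mp hπirr
  have hsmul : ∀ z : R, (f • d) z = f * d z := fun z => by rw [Derivation.smul_apply, smul_eq_mul]
  by_cases hA : π ^ 2 ∣ f ∨ π ∣ d π
  · -- Case A: `δ := f • d` raises `π`-adic order by one, so `δ x = 0` for all `x`.
    have key : ∀ (j : ℕ) (z : R), π ^ j ∣ z → π ^ (j + 1) ∣ (f • d) z := by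
      intro j z hz
      rw [hsmul]
      rcases hA with h | h
      · exact pow_succ_dvd_mul_apply_of_sq_dvd d h j hz
      · exact pow_succ_dvd_mul_apply_of_dvd_apply d hπf h j hz
    obtain ⟨x, hx⟩ : ∃ x, d x ≠ 0 := by
      by_contra h
      push Not at h
      exact hd (Derivation.ext h)
    have hfdx : (f • d) x ≠ 0 := by rw [hsmul]; exact mul_ne_zero hf0 hx
    have step : ∀ j, π ^ j ∣ (f • d) x → π ^ (j + (p - 1)) ∣ (f • d) x := by
      intro j hj
      have h1 := pow_add_dvd_iterate key (p - 1) j hj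
      have h2 : (⇑(f • d))^[p - 1] ((f • d) x) = (⇑(f • d))^[p] x := by
        rw [← Function.iterate_succ_apply, Nat.succ_eq_add_one, Nat.sub_add_cancel (by omega)]
      rw [h2, hmult x] at h1
      exact (hu.dvd_mul_left).mp h1
    have hall : ∀ n, π ^ n ∣ (f • d) x := by
      intro n
      induction n with
      | zero => simp
      | succ n ih => exact (pow_dvd_pow π (by omega : n + 1 ≤ n + (p - 1))).trans (step n ih)
    obtain ⟨n, a, hna, heq⟩ := WfDvdMonoid.max_power_factor' hfdx hπ.not_unit
    apply hna
    have h := hall (n + 1)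
    rw [heq, pow_succ] at h
    exact (mul_dvd_mul_iff_left (pow_ne_zero n hπ.ne_zero)).mp h
  · -- Case B: `f = π v`, `π ∤ v`, `π ∤ d π`; follow `δ^[m] π = π y_m`, `y_m ≡ (v dπ)^m (mod π)`.
    push Not at hA
    obtain ⟨hsq, hdπ⟩ := hA
    obtain ⟨v, rfl⟩ := hπf
    have hv : ¬ π ∣ v := by
      rintro ⟨w, rfl⟩
      exact hsq ⟨w, by ring⟩
    have seq : ∀ m : ℕ, ∃ y : R, (⇑((π * v) • d))^[m + 1] π = π * y ∧
        π ∣ y - (v * d π) ^ (m + 1) := by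
      intro m
      induction m with
      | zero =>
        refine ⟨v * d π, ?_, by simp⟩
        rw [Function.iterate_one, hsmul]
        ring
      | succ m ih =>
        obtain ⟨y, hy, hdvd⟩ := ih
        refine ⟨v * (d π * y + π * d y), ?_, ?_⟩
        · rw [Function.iterate_succ_apply', hy, hsmul, d.leibniz, smul_eq_mul, smul_eq_mul]
          ring
        · have : v * (d π * y + π * d y) - (v * d π) ^ (m + 1 + 1) =
              v * d π * (y - (v * d π) ^ (m + 1)) + π * (v * d y) := by ring
          rw [this]
          exact dvd_add (Dvd.dvd.mul_left hdvd _) (dvd_mul_right _ _)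
    obtain ⟨y, hy, hdvd⟩ := seq (p - 1)
    rw [Nat.sub_add_cancel (by omega : 1 ≤ p)] at hy hdvd
    have h2 := hmult π
    rw [hy, hsmul] at h2
    -- `π * y = u * (π * v * d π)`, cancel `π`
    have hy' : y = u * v * d π := by
      apply mul_left_cancel₀ hπ.ne_zero
      rw [h2]
      ring
    rw [hy'] at hdvd
    have hfac : u * v * d π - (v * d π) ^ p = (v * d π) * (u - (v * d π) ^ (p - 1)) := by
      conv_lhs => rw [← Nat.sub_add_cancel (by omega : 1 ≤ p), pow_succ']
      ring
    rw [hfac] at hdvd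
    rcases hπ.dvd_or_dvd hdvd with h | h
    · rcases hπ.dvd_or_dvd h with h' | h'
      · exact hv h'
      · exact hdπ h'
    · -- `u - (v dπ)^(p-1)` is a unit of the local ring `R` (`d π` is not a unit, `p - 1 ≥ 1`)
      have hnu : ¬ IsUnit ((v * d π) ^ (p - 1)) := by
        rw [isUnit_pow_iff (by omega : p - 1 ≠ 0)]
        intro h''
        exact hcon π (isUnit_of_mul_isUnit_right h'')
      have hunit : IsUnit (u - (v * d π) ^ (p - 1)) := by
        by_contra hnunit
        have hsum : u - (v * d π) ^ (p - 1) + (v * d π) ^ (p - 1) ∈ nonunits R :=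
          IsLocalRing.nonunits_add hnunit hnu
        rw [sub_add_cancel] at hsum
        exact hsum hu
      exact hπ.not_unit (isUnit_of_dvd_unit h hunit)

end Summit.ResolutionOfSingularities.ResolutionOfSingularities.Theorems.FolLU.SatMult
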